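import Summits.ABC.ABC.Theorems.IneffectiveSubspaceDepthCountedABCStubRidoutSmallMember
import Summits.ABC.ABC.Theorems.IneffectiveSubspaceDeepRegimeABCRoughPowerfulTail

/-!
# Line `Sketch` — crux `IneffectiveSubspace.DepthCountedABC` (stmt-ABC-14938): Ridout localisation of the T core

CERTIFICATE (registered certificate stub `stub_ridoutLocalDeepSmallFullSizeIff`, not load-bearing in `DepthCountedABC_of`;
lands `--supports stmt-ABC-14938`).  The T-statements of line
`Sketch` ("small member `a` at full size": `c < C·(a·rad(bc))^(1+δ)` on a class of abc triples) are
OPEN on every cell (cores `stub_LW4 → … → SmallFullSizeFiveFree`, `stub_deepSmallFullSize`).  This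
file proves that, for an ARBITRARY side condition `P a b c`, the T-statement on `P` is EQUIVALENT to
the T-statement on the sub-class of `P` where the `y`-ROUGH POWERFUL EXCESS of `abc`,
`X_y(abc) := Σ_{p > y, p ∣ abc} (v_p(abc) − 1)·log p`, is at least `θ·log c` — for every `0 < θ`
with `θ(1+δ) < δ`, with `y` and `C` free (`ridoutLocal_smallFullSize_iff`).  In words: the open
content of the T core sits entirely on the triples whose large members carry a powerful part of
size `≥ c^θ` made of primes `> y`; triples whose powerfulness comes from small primes, or is
`o(log c)`, are settled by Ridout's theorem.  This is the T-analogue of the landed Ridout normal form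
of the crux (`stub_roughPowerfulCellIff`, p140411) and it is what the skeleton's docstrings of the
cores `stub_deepSmallFullSize` / `stub_LW4` now point to (`ridoutLocal_deepSmallFullSize_iff`,
`ridoutLocal_smallFullSizeFiveFree_iff`).

PROOF (`←`).  Given `δ`, put `θ := δ/(2(1+δ))`, `δ' := δ/(2+δ)` (so `θ(1+δ') = δ'` and
`(1+δ')/(1−δ') = 1+δ`); take `y, C₀` from the hypothesis and `C₁` from the landed Ridout stratum
`ridoutSmallMember_rough y δ'` (`c ≤ C₁·(a·rough_y(bc))^(1+δ')` for EVERY abc triple, p141112).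
A triple of `P` with `X_y(abc) ≥ θ log c` is bounded by the hypothesis.  Otherwise
`log rough_y(bc) = X_y(bc) + Σ_{p>y, p∣bc} log p ≤ X_y(abc) + log rad(bc) < θ log c + log rad(bc)`
(`ridoutLocal_excess_mono`, `ridoutLocal_log_rough_le`), so `rough_y(bc) ≤ c^θ·rad(bc)` and Ridout
gives `c ≤ C₁·c^(θ(1+δ'))·(a·rad(bc))^(1+δ') = C₁·c^δ'·X^(1+δ')`, i.e. `c^(1−δ') ≤ C₁ X^(1+δ')`,
`c ≤ C₁^(1+δ/2)·X^(1+δ)` (`(1−δ')(1+δ/2) = 1`).  Answer `C := max C₀ (C₁^(1+δ/2) + 1)`.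
(`→`: ignore the excess hypothesis, `y := 0`.)

Sources: elementary bookkeeping (folklore) over the landed `stub_ridoutSmallMember` (whose only deep
input is the tree-proved Ridout theorem, `DeepRegimeABC.ridoutCoreBound_holds`, B–G Thm. 6.2.3).
Deliberately NOT here: any claim about the cores themselves (open), the crux, or the P-statement;
no new definitions are introduced.
-/

-- `Summit.<Summit>.<Problem>` is the mandated summit-side namespace (CONVENTIONS §2); for the
-- single-conjunct summit `ABC` the two coincide, so the duplicate `ABC.ABC` is deliberate.
set_option linter.dupNamespace false

namespace Summit.ABC.ABC.Theorems.DepthCountedABC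

open Literature.NumberTheory.DiophantineGeometry UniqueFactorizationMonoid

/-! ### Mass bookkeeping: the rough part of `bc` against the rough powerful excess of `abc` -/

/-- **Excess monotonicity.**  For `a ≠ 0`, `bc ≠ 0` the `y`-rough powerful excess of `bc` is at most
that of `abc`: `Σ_{p>y, p∣bc}(v_p(bc) − 1) log p ≤ Σ_{p>y, p∣abc}(v_p(abc) − 1) log p`
(`v_p(abc) = v_p(a) + v_p(bc) ≥ v_p(bc)`, and the extra primes of `a` contribute `≥ 0`). [folklore] -/
theorem ridoutLocal_excess_mono {a b c : ℕ} (y : ℕ) (ha : a ≠ 0) (hbc : b * c ≠ 0) :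
    ∑ p ∈ (b * c).primeFactors.filter (fun p => ¬ p ≤ y),
        (((b * c).factorization p : ℝ) - 1) * Real.log p ≤
      ∑ p ∈ (a * b * c).primeFactors.filter (fun p => ¬ p ≤ y),
        (((a * b * c).factorization p : ℝ) - 1) * Real.log p := by
  have habc0 : a * (b * c) ≠ 0 := mul_ne_zero ha hbc
  rw [mul_assoc]
  have hsub : (b * c).primeFactors.filter (fun p => ¬ p ≤ y) ⊆
      (a * (b * c)).primeFactors.filter (fun p => ¬ p ≤ y) :=
    Finset.filter_subset_filter _ (Nat.primeFactors_mono (dvd_mul_left (b * c) a) habc0)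
  have hlog0 : ∀ p ∈ (a * (b * c)).primeFactors.filter (fun p => ¬ p ≤ y), (0 : ℝ) ≤ Real.log p :=
    fun p hp => Real.log_nonneg
      (by exact_mod_cast (Nat.prime_of_mem_primeFactors (Finset.mem_filter.1 hp).1).one_lt.le)
  have hfac : ∀ p : ℕ, ((a * (b * c)).factorization p : ℝ) =
      (a.factorization p : ℝ) + ((b * c).factorization p : ℝ) := by
    intro p
    rw [Nat.factorization_mul ha hbc, Finsupp.coe_add, Pi.add_apply, Nat.cast_add]
  calc ∑ p ∈ (b * c).primeFactors.filter (fun p => ¬ p ≤ y),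
        (((b * c).factorization p : ℝ) - 1) * Real.log p
      ≤ ∑ p ∈ (b * c).primeFactors.filter (fun p => ¬ p ≤ y),
          (((a * (b * c)).factorization p : ℝ) - 1) * Real.log p := by
        refine Finset.sum_le_sum fun p hp => ?_
        refine mul_le_mul_of_nonneg_right ?_ (hlog0 p (hsub hp))
        rw [hfac p]
        linarith [(Nat.cast_nonneg (a.factorization p) : (0 : ℝ) ≤ _)]
    _ ≤ ∑ p ∈ (a * (b * c)).primeFactors.filter (fun p => ¬ p ≤ y),
          (((a * (b * c)).factorization p : ℝ) - 1) * Real.log p := by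
        refine Finset.sum_le_sum_of_subset_of_nonneg hsub fun p hp _ => ?_
        refine mul_nonneg ?_ (hlog0 p hp)
        have h1 : 1 ≤ (a * (b * c)).factorization p :=
          (Nat.prime_of_mem_primeFactors (Finset.mem_filter.1 hp).1).factorization_pos_of_dvd habc0
            (Nat.dvd_of_mem_primeFactors (Finset.mem_filter.1 hp).1)
        have h1' : (1 : ℝ) ≤ ((a * (b * c)).factorization p : ℝ) := by exact_mod_cast h1
        linarith

/-- **Rough part against excess and radical.**
`log rough_y(bc) ≤ X_y(bc) + log rad(bc)`, where `rough_y(bc) = ∏_{p>y, p∣bc} p^{v_p(bc)}` and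
`X_y(bc) = Σ_{p>y, p∣bc}(v_p(bc) − 1) log p` (`log rough_y = X_y + Σ_{p>y, p∣bc} log p` and
`Σ_{p>y, p∣bc} log p ≤ Σ_{p∣bc} log p = log rad(bc)`). [folklore] -/
theorem ridoutLocal_log_rough_le (b c y : ℕ) :
    Real.log ((∏ p ∈ (b * c).primeFactors.filter (fun p => ¬ p ≤ y),
        p ^ (b * c).factorization p : ℕ) : ℝ) ≤
      (∑ p ∈ (b * c).primeFactors.filter (fun p => ¬ p ≤ y),
          (((b * c).factorization p : ℝ) - 1) * Real.log p)
        + Real.log ((radical (b * c) : ℕ) : ℝ) := by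
  have hlog0 : ∀ p ∈ (b * c).primeFactors, (0 : ℝ) ≤ Real.log p := fun p hp =>
    Real.log_nonneg (by exact_mod_cast (Nat.prime_of_mem_primeFactors hp).one_lt.le)
  -- `log rough = Σ v_p log p`
  have hrough : Real.log ((∏ p ∈ (b * c).primeFactors.filter (fun p => ¬ p ≤ y),
      p ^ (b * c).factorization p : ℕ) : ℝ) =
      ∑ p ∈ (b * c).primeFactors.filter (fun p => ¬ p ≤ y),
        ((b * c).factorization p : ℝ) * Real.log p := by
    push_cast
    rw [Real.log_prod]
    · exact Finset.sum_congr rfl fun p _ => by rw [Real.log_pow]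
    · intro p hp
      exact pow_ne_zero _ (by
        exact_mod_cast (Nat.prime_of_mem_primeFactors (Finset.mem_filter.1 hp).1).ne_zero)
  -- `log rad(bc) = Σ_{p ∣ bc} log p ≥ Σ_{p>y, p∣bc} log p`
  have hrad : ∑ p ∈ (b * c).primeFactors.filter (fun p => ¬ p ≤ y), Real.log p ≤
      Real.log ((radical (b * c) : ℕ) : ℝ) := by
    rw [Nat.radical_eq_prod_primeFactors]
    push_cast
    rw [Real.log_prod]
    · exact Finset.sum_le_sum_of_subset_of_nonneg (Finset.filter_subset _ _) fun p hp _ => hlog0 p hp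
    · intro p hp
      exact_mod_cast (Nat.prime_of_mem_primeFactors hp).ne_zero
  have hsplit : ∑ p ∈ (b * c).primeFactors.filter (fun p => ¬ p ≤ y),
        ((b * c).factorization p : ℝ) * Real.log p =
      (∑ p ∈ (b * c).primeFactors.filter (fun p => ¬ p ≤ y),
          (((b * c).factorization p : ℝ) - 1) * Real.log p)
        + ∑ p ∈ (b * c).primeFactors.filter (fun p => ¬ p ≤ y), Real.log p := by
    rw [← Finset.sum_add_distrib]
    exact Finset.sum_congr rfl fun p _ => by ring
  rw [hrough, hsplit]
  linarith [hrad]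

/-- **Small excess ⟹ the rough part of `bc` is radical-like.**  For an abc triple `(a, b, c)` whose
`y`-rough powerful excess `X_y(abc)` is `< θ·log c`:  `rough_y(bc) ≤ c^θ · rad(bc)`. [folklore] -/
theorem ridoutLocal_rough_le {a b c y : ℕ} {θ : ℝ} (habc : IsABCTriple a b c)
    (hX : ∑ p ∈ (a * b * c).primeFactors.filter (fun p => ¬ p ≤ y),
        (((a * b * c).factorization p : ℝ) - 1) * Real.log p < θ * Real.log c) :
    ((∏ p ∈ (b * c).primeFactors.filter (fun p => ¬ p ≤ y), p ^ (b * c).factorization p : ℕ) : ℝ) ≤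
      (c : ℝ) ^ θ * ((radical (b * c) : ℕ) : ℝ) := by
  obtain ⟨ha, hb, hsum, -⟩ := habc
  have hc : 0 < c := by omega
  have hcR : (0 : ℝ) < (c : ℝ) := by exact_mod_cast hc
  have hbc : b * c ≠ 0 := (Nat.mul_pos hb hc).ne'
  have hrad0 : (0 : ℝ) < ((radical (b * c) : ℕ) : ℝ) := by
    exact_mod_cast Nat.pos_of_ne_zero radical_ne_zero
  have hrough0 : (0 : ℝ) < ((∏ p ∈ (b * c).primeFactors.filter (fun p => ¬ p ≤ y),
      p ^ (b * c).factorization p : ℕ) : ℝ) := by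
    exact_mod_cast Finset.prod_pos fun p hp =>
      pow_pos (Nat.prime_of_mem_primeFactors (Finset.mem_filter.1 hp).1).pos _
  have h1 := ridoutLocal_log_rough_le b c y
  have h2 := ridoutLocal_excess_mono y ha.ne' hbc
  have hlog : Real.log ((∏ p ∈ (b * c).primeFactors.filter (fun p => ¬ p ≤ y),
      p ^ (b * c).factorization p : ℕ) : ℝ) ≤
      Real.log ((c : ℝ) ^ θ * ((radical (b * c) : ℕ) : ℝ)) := by
    rw [Real.log_mul (Real.rpow_pos_of_pos hcR θ).ne' hrad0.ne', Real.log_rpow hcR]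
    linarith
  exact (Real.log_le_log_iff hrough0 (mul_pos (Real.rpow_pos_of_pos hcR θ) hrad0)).1 hlog

/-! ### The localisation of the T-statement on an arbitrary class `P` -/

/-- **Localisation (`←`): T on the rough-powerful part of `P` implies T on `P`.**  If for every
`δ > 0` and every `0 < θ` with `θ(1+δ) < δ` there are `y, C` with `c < C·(a·rad(bc))^(1+δ)` for the
abc triples of `P` whose `y`-rough powerful excess of `abc` is `≥ θ·log c`, then for every `δ > 0`
there is `C` with `c < C·(a·rad(bc))^(1+δ)` for ALL abc triples of `P`: the remaining triples have
`rough_y(bc) ≤ c^θ·rad(bc)` (`ridoutLocal_rough_le`) and are settled by the Ridout stratum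
`ridoutSmallMember_rough` (p141112) with `θ = δ/(2(1+δ))`, `δ' = δ/(2+δ)`. [folklore] -/
theorem ridoutLocal_smallFullSize_of_rough (P : ℕ → ℕ → ℕ → Prop)
    (hT : ∀ δ : ℝ, 0 < δ → ∀ θ : ℝ, 0 < θ → θ * (1 + δ) < δ → ∃ y : ℕ, ∃ C : ℝ, 0 < C ∧
      ∀ a b c : ℕ, IsABCTriple a b c → P a b c →
        θ * Real.log c ≤
          ∑ p ∈ (a * b * c).primeFactors.filter (fun p => ¬ p ≤ y),
            (((a * b * c).factorization p : ℝ) - 1) * Real.log p →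
        (c : ℝ) < C * ((a : ℝ) * ((radical (b * c) : ℕ) : ℝ)) ^ (1 + δ)) :
    ∀ δ : ℝ, 0 < δ → ∃ C : ℝ, 0 < C ∧ ∀ a b c : ℕ, IsABCTriple a b c → P a b c →
      (c : ℝ) < C * ((a : ℝ) * ((radical (b * c) : ℕ) : ℝ)) ^ (1 + δ) := by
  intro δ hδ
  have hδ1 : (0 : ℝ) < 1 + δ := by linarith
  have hδ2 : (0 : ℝ) < 2 + δ := by linarith
  have hδh : (0 : ℝ) < 1 + δ / 2 := by linarith
  -- parameters: `θ = δ/(2(1+δ))`, `δ' = δ/(2+δ)`; identities `θ(1+δ') = δ'`, `1 - δ' = 1/(1+δ/2)`,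
  -- `(1+δ')(1+δ/2) = 1+δ`
  set θ : ℝ := δ / (2 * (1 + δ)) with hθ
  have hθ0 : 0 < θ := by positivity
  have hθ1 : θ * (1 + δ) < δ := by
    have : θ * (1 + δ) = δ / 2 := by rw [hθ]; field_simp
    rw [this]; linarith
  set δ' : ℝ := δ / (2 + δ) with hδ'
  have hδ'0 : 0 < δ' := div_pos hδ hδ2
  have hθδ' : θ * (1 + δ') = δ' := by
    rw [hθ, hδ']; field_simp; ring
  have h1δ' : 1 - δ' = 1 / (1 + δ / 2) := by
    rw [hδ']; field_simp; ring
  have hexp : (1 + δ') * (1 + δ / 2) = 1 + δ := by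
    rw [hδ']; field_simp; ring
  obtain ⟨y, C₀, hC₀, hmain⟩ := hT δ hδ θ hθ0 hθ1
  obtain ⟨C₁, hC₁, hR⟩ := ridoutSmallMember_rough y δ' hδ'0
  set C₂ : ℝ := C₁ ^ (1 + δ / 2) + 1 with hC₂
  have hC₂0 : 0 < C₂ := by
    have := Real.rpow_pos_of_pos hC₁ (1 + δ / 2)
    rw [hC₂]; linarith
  refine ⟨max C₀ C₂, lt_max_of_lt_left hC₀, fun a b c habc hP => ?_⟩
  obtain ⟨ha, hb, hsum, -⟩ := id habc
  have hc : 0 < c := by omega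
  have hcR : (0 : ℝ) < (c : ℝ) := by exact_mod_cast hc
  have haR : (1 : ℝ) ≤ (a : ℝ) := by exact_mod_cast ha
  have hrad1 : (1 : ℝ) ≤ ((radical (b * c) : ℕ) : ℝ) := by
    exact_mod_cast Nat.pos_of_ne_zero radical_ne_zero
  -- `X := a · rad(bc) ≥ 1`
  set X : ℝ := (a : ℝ) * ((radical (b * c) : ℕ) : ℝ) with hXdef
  have hX1 : (1 : ℝ) ≤ X := by rw [hXdef]; nlinarith
  have hX0 : (0 : ℝ) ≤ X := zero_le_one.trans hX1
  have hXpow0 : (0 : ℝ) ≤ X ^ (1 + δ) := Real.rpow_nonneg hX0 _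
  by_cases hXy : θ * Real.log c ≤
      ∑ p ∈ (a * b * c).primeFactors.filter (fun p => ¬ p ≤ y),
        (((a * b * c).factorization p : ℝ) - 1) * Real.log p
  · -- rough-powerful: the hypothesis
    calc (c : ℝ) < C₀ * X ^ (1 + δ) := hmain a b c habc hP hXy
      _ ≤ max C₀ C₂ * X ^ (1 + δ) := mul_le_mul_of_nonneg_right (le_max_left _ _) hXpow0
  · -- small excess: Ridout
    have hrough := ridoutLocal_rough_le (y := y) habc (not_le.mp hXy)
    have hcθ : (0 : ℝ) < (c : ℝ) ^ θ := Real.rpow_pos_of_pos hcR θ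
    have hrough0 : (0 : ℝ) ≤ ((∏ p ∈ (b * c).primeFactors.filter (fun p => ¬ p ≤ y),
        p ^ (b * c).factorization p : ℕ) : ℝ) := Nat.cast_nonneg _
    -- Ridout: `c ≤ C₁ (a·rough)^(1+δ') ≤ C₁ (a·(c^θ·rad))^(1+δ') = C₁ c^(θ(1+δ')) X^(1+δ')`
    have h1 := hR a b c habc
    have h2 : ((a : ℝ) * ((∏ p ∈ (b * c).primeFactors.filter (fun p => ¬ p ≤ y),
        p ^ (b * c).factorization p : ℕ) : ℝ)) ^ (1 + δ') ≤
        ((a : ℝ) * ((c : ℝ) ^ θ * ((radical (b * c) : ℕ) : ℝ))) ^ (1 + δ') :=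
      Real.rpow_le_rpow (mul_nonneg (by positivity) hrough0)
        (mul_le_mul_of_nonneg_left hrough (by positivity)) (by linarith)
    have h3 : ((a : ℝ) * ((c : ℝ) ^ θ * ((radical (b * c) : ℕ) : ℝ))) ^ (1 + δ') =
        (c : ℝ) ^ δ' * X ^ (1 + δ') := by
      have hsw : (a : ℝ) * ((c : ℝ) ^ θ * ((radical (b * c) : ℕ) : ℝ)) = (c : ℝ) ^ θ * X := by
        rw [hXdef]; ring
      rw [hsw, Real.mul_rpow hcθ.le hX0, ← Real.rpow_mul hcR.le, hθδ']
    have h4 : (c : ℝ) ≤ C₁ * X ^ (1 + δ') * (c : ℝ) ^ δ' := by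
      calc (c : ℝ) ≤ C₁ * ((a : ℝ) * ((∏ p ∈ (b * c).primeFactors.filter (fun p => ¬ p ≤ y),
            p ^ (b * c).factorization p : ℕ) : ℝ)) ^ (1 + δ') := h1
        _ ≤ C₁ * ((a : ℝ) * ((c : ℝ) ^ θ * ((radical (b * c) : ℕ) : ℝ))) ^ (1 + δ') :=
            mul_le_mul_of_nonneg_left h2 hC₁.le
        _ = C₁ * X ^ (1 + δ') * (c : ℝ) ^ δ' := by rw [h3]; ring
    -- extract: `c^(1-δ') ≤ C₁ X^(1+δ')`, `1 - δ' = 1/(1+δ/2)`, raise to `1 + δ/2`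
    have h5 : (c : ℝ) ^ (1 / (1 + δ / 2)) ≤ C₁ * X ^ (1 + δ') := by
      rw [← h1δ', Real.rpow_sub hcR, Real.rpow_one, div_le_iff₀ (Real.rpow_pos_of_pos hcR δ')]
      exact h4
    have h6 : (c : ℝ) = ((c : ℝ) ^ (1 / (1 + δ / 2))) ^ (1 + δ / 2) := by
      rw [← Real.rpow_mul hcR.le, one_div_mul_cancel hδh.ne', Real.rpow_one]
    have hK0 : (0 : ℝ) ≤ C₁ * X ^ (1 + δ') := mul_nonneg hC₁.le (Real.rpow_nonneg hX0 _)
    have h7 : (c : ℝ) ≤ C₁ ^ (1 + δ / 2) * X ^ (1 + δ) := by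
      calc (c : ℝ) = ((c : ℝ) ^ (1 / (1 + δ / 2))) ^ (1 + δ / 2) := h6
        _ ≤ (C₁ * X ^ (1 + δ')) ^ (1 + δ / 2) :=
            Real.rpow_le_rpow (Real.rpow_nonneg hcR.le _) h5 hδh.le
        _ = C₁ ^ (1 + δ / 2) * X ^ (1 + δ) := by
            rw [Real.mul_rpow hC₁.le (Real.rpow_nonneg hX0 _), ← Real.rpow_mul hX0, hexp]
    have hX1pow : (1 : ℝ) ≤ X ^ (1 + δ) := Real.one_le_rpow hX1 hδ1.le
    calc (c : ℝ) ≤ C₁ ^ (1 + δ / 2) * X ^ (1 + δ) := h7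
      _ < C₂ * X ^ (1 + δ) := by
          rw [hC₂]; nlinarith
      _ ≤ max C₀ C₂ * X ^ (1 + δ) := mul_le_mul_of_nonneg_right (le_max_right _ _) hXpow0

/-- **Localisation (`→`): T on `P` implies T on the rough-powerful part of `P`** (ignore the excess
hypothesis; `y := 0`). [folklore] -/
theorem ridoutLocal_rough_of_smallFullSize (P : ℕ → ℕ → ℕ → Prop)
    (h : ∀ δ : ℝ, 0 < δ → ∃ C : ℝ, 0 < C ∧ ∀ a b c : ℕ, IsABCTriple a b c → P a b c →
      (c : ℝ) < C * ((a : ℝ) * ((radical (b * c) : ℕ) : ℝ)) ^ (1 + δ)) :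
    ∀ δ : ℝ, 0 < δ → ∀ θ : ℝ, 0 < θ → θ * (1 + δ) < δ → ∃ y : ℕ, ∃ C : ℝ, 0 < C ∧
      ∀ a b c : ℕ, IsABCTriple a b c → P a b c →
        θ * Real.log c ≤
          ∑ p ∈ (a * b * c).primeFactors.filter (fun p => ¬ p ≤ y),
            (((a * b * c).factorization p : ℝ) - 1) * Real.log p →
        (c : ℝ) < C * ((a : ℝ) * ((radical (b * c) : ℕ) : ℝ)) ^ (1 + δ) := by
  intro δ hδ θ _ _
  obtain ⟨C, hC, hh⟩ := h δ hδ
  exact ⟨0, C, hC, fun a b c habc hP _ => hh a b c habc hP⟩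

/-- **Ridout localisation of the T core (any class `P`).**  The T-statement
`∀ δ > 0 ∃ C ∀ abc triples in P, c < C·(a·rad(bc))^(1+δ)` is EQUIVALENT to its restriction to the
triples of `P` whose `y`-rough powerful excess `Σ_{p>y, p∣abc}(v_p(abc) − 1) log p` is `≥ θ·log c`
(`0 < θ`, `θ(1+δ) < δ`; `y, C` free).  Ridout's theorem (through `ridoutSmallMember_rough`) settles
every other configuration. [folklore] -/
theorem ridoutLocal_smallFullSize_iff (P : ℕ → ℕ → ℕ → Prop) :
    (∀ δ : ℝ, 0 < δ → ∃ C : ℝ, 0 < C ∧ ∀ a b c : ℕ, IsABCTriple a b c → P a b c →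
      (c : ℝ) < C * ((a : ℝ) * ((radical (b * c) : ℕ) : ℝ)) ^ (1 + δ)) ↔
    (∀ δ : ℝ, 0 < δ → ∀ θ : ℝ, 0 < θ → θ * (1 + δ) < δ → ∃ y : ℕ, ∃ C : ℝ, 0 < C ∧
      ∀ a b c : ℕ, IsABCTriple a b c → P a b c →
        θ * Real.log c ≤
          ∑ p ∈ (a * b * c).primeFactors.filter (fun p => ¬ p ≤ y),
            (((a * b * c).factorization p : ℝ) - 1) * Real.log p →
        (c : ℝ) < C * ((a : ℝ) * ((radical (b * c) : ℕ) : ℝ)) ^ (1 + δ)) :=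
  ⟨ridoutLocal_rough_of_smallFullSize P, ridoutLocal_smallFullSize_of_rough P⟩

/-! ### The two T cores of line `Sketch`, localised -/

/-- **The deep T core, localised.**  The registered core `stub_deepSmallFullSize` of line `Sketch`
(T on the deep cells `1 ≤ ω₅(abc) ≤ K`, every `K`) is equivalent to T on the deep cells restricted to
the triples whose `y`-rough powerful excess of `abc` is `≥ θ·log c` (`0 < θ`, `θ(1+δ) < δ`; `y, C`
free): `ridoutLocal_smallFullSize_iff` with `P := (1 ≤ ω₅(abc) ≤ K)`, cell by cell. [folklore] -/
theorem ridoutLocal_deepSmallFullSize_iff :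
    (∀ K : ℕ, ∀ δ : ℝ, 0 < δ → ∃ C : ℝ, 0 < C ∧ ∀ a b c : ℕ, IsABCTriple a b c →
      1 ≤ ((a * b * c).primeFactors.filter (fun p => 5 ≤ (a * b * c).factorization p)).card →
      ((a * b * c).primeFactors.filter (fun p => 5 ≤ (a * b * c).factorization p)).card ≤ K →
      (c : ℝ) < C * ((a : ℝ) * ((radical (b * c) : ℕ) : ℝ)) ^ (1 + δ)) ↔
    (∀ K : ℕ, ∀ δ : ℝ, 0 < δ → ∀ θ : ℝ, 0 < θ → θ * (1 + δ) < δ → ∃ y : ℕ, ∃ C : ℝ, 0 < C ∧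
      ∀ a b c : ℕ, IsABCTriple a b c →
      1 ≤ ((a * b * c).primeFactors.filter (fun p => 5 ≤ (a * b * c).factorization p)).card →
      ((a * b * c).primeFactors.filter (fun p => 5 ≤ (a * b * c).factorization p)).card ≤ K →
        θ * Real.log c ≤
          ∑ p ∈ (a * b * c).primeFactors.filter (fun p => ¬ p ≤ y),
            (((a * b * c).factorization p : ℝ) - 1) * Real.log p →
        (c : ℝ) < C * ((a : ℝ) * ((radical (b * c) : ℕ) : ℝ)) ^ (1 + δ)) := by
  constructor
  · intro h K
    have hK := ridoutLocal_rough_of_smallFullSize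
      (fun a b c => 1 ≤ ((a * b * c).primeFactors.filter
          (fun p => 5 ≤ (a * b * c).factorization p)).card ∧
        ((a * b * c).primeFactors.filter (fun p => 5 ≤ (a * b * c).factorization p)).card ≤ K)
      (fun δ hδ => by
        obtain ⟨C, hC, hh⟩ := h K δ hδ
        exact ⟨C, hC, fun a b c habc hP => hh a b c habc hP.1 hP.2⟩)
    intro δ hδ θ hθ hθδ
    obtain ⟨y, C, hC, hh⟩ := hK δ hδ θ hθ hθδ
    exact ⟨y, C, hC, fun a b c habc h1 h2 hX => hh a b c habc ⟨h1, h2⟩ hX⟩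
  · intro h K
    have hK := ridoutLocal_smallFullSize_of_rough
      (fun a b c => 1 ≤ ((a * b * c).primeFactors.filter
          (fun p => 5 ≤ (a * b * c).factorization p)).card ∧
        ((a * b * c).primeFactors.filter (fun p => 5 ≤ (a * b * c).factorization p)).card ≤ K)
      (fun δ hδ θ hθ hθδ => by
        obtain ⟨y, C, hC, hh⟩ := h K δ hδ θ hθ hθδ
        exact ⟨y, C, hC, fun a b c habc hP hX => hh a b c habc hP.1 hP.2 hX⟩)
    intro δ hδ
    obtain ⟨C, hC, hh⟩ := hK δ hδ
    exact ⟨C, hC, fun a b c habc h1 h2 => hh a b c habc ⟨h1, h2⟩⟩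

/-- **The 5-free T core, localised.**  `SmallFullSizeFiveFree` (T on the cell `ω₅(abc) = 0`, the
target of `stub_LW4 → stub_dictionary → stub_base`) is equivalent to T on the 5-free triples whose
`y`-rough powerful excess of `abc` is `≥ θ·log c` (`0 < θ`, `θ(1+δ) < δ`; `y, C` free) — on the
5-free cell that excess is carried by primes `p > y` with `v_p(abc) ∈ {2, 3, 4}`. [folklore] -/
theorem ridoutLocal_smallFullSizeFiveFree_iff :
    (∀ δ : ℝ, 0 < δ → ∃ C : ℝ, 0 < C ∧ ∀ a b c : ℕ, IsABCTriple a b c →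
      ((a * b * c).primeFactors.filter (fun p => 5 ≤ (a * b * c).factorization p)).card = 0 →
      (c : ℝ) < C * ((a : ℝ) * ((radical (b * c) : ℕ) : ℝ)) ^ (1 + δ)) ↔
    (∀ δ : ℝ, 0 < δ → ∀ θ : ℝ, 0 < θ → θ * (1 + δ) < δ → ∃ y : ℕ, ∃ C : ℝ, 0 < C ∧
      ∀ a b c : ℕ, IsABCTriple a b c →
      ((a * b * c).primeFactors.filter (fun p => 5 ≤ (a * b * c).factorization p)).card = 0 →
        θ * Real.log c ≤
          ∑ p ∈ (a * b * c).primeFactors.filter (fun p => ¬ p ≤ y),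
            (((a * b * c).factorization p : ℝ) - 1) * Real.log p →
        (c : ℝ) < C * ((a : ℝ) * ((radical (b * c) : ℕ) : ℝ)) ^ (1 + δ)) :=
  ridoutLocal_smallFullSize_iff
    (fun a b c => ((a * b * c).primeFactors.filter (fun p => 5 ≤ (a * b * c).factorization p)).card = 0)

/-- **Registered certificate stub `stub_ridoutLocalDeepSmallFullSizeIff` (line `Sketch`, crux stmt-ABC-14938):
the deep T core `stub_deepSmallFullSize` is equivalent to its Ridout localisation** (verbatim
`ridoutLocal_deepSmallFullSize_iff`, stated with fully qualified names as registered). [folklore] -/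
theorem stub_ridoutLocalDeepSmallFullSizeIff :
    (∀ K : ℕ, ∀ δ : ℝ, 0 < δ → ∃ C : ℝ, 0 < C ∧ ∀ a b c : ℕ,
      Literature.NumberTheory.DiophantineGeometry.IsABCTriple a b c →
      1 ≤ ((a * b * c).primeFactors.filter (fun p => 5 ≤ (a * b * c).factorization p)).card →
      ((a * b * c).primeFactors.filter (fun p => 5 ≤ (a * b * c).factorization p)).card ≤ K →
      (c : ℝ) < C * ((a : ℝ) * ((UniqueFactorizationMonoid.radical (b * c) : ℕ) : ℝ)) ^ (1 + δ)) ↔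
    (∀ K : ℕ, ∀ δ : ℝ, 0 < δ → ∀ θ : ℝ, 0 < θ → θ * (1 + δ) < δ → ∃ y : ℕ, ∃ C : ℝ, 0 < C ∧
      ∀ a b c : ℕ, Literature.NumberTheory.DiophantineGeometry.IsABCTriple a b c →
      1 ≤ ((a * b * c).primeFactors.filter (fun p => 5 ≤ (a * b * c).factorization p)).card →
      ((a * b * c).primeFactors.filter (fun p => 5 ≤ (a * b * c).factorization p)).card ≤ K →
        θ * Real.log c ≤
          ∑ p ∈ (a * b * c).primeFactors.filter (fun p => ¬ p ≤ y),
            (((a * b * c).factorization p : ℝ) - 1) * Real.log p →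
        (c : ℝ) < C * ((a : ℝ) * ((UniqueFactorizationMonoid.radical (b * c) : ℕ) : ℝ)) ^ (1 + δ)) :=
  ridoutLocal_deepSmallFullSize_iff

end Summit.ABC.ABC.Theorems.DepthCountedABC
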